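import Literature.MeasureTheory.Group.InvariantQuotientTransport   -- ★ `cosetCongr`, `subgroupCongrHomeomorph`, `map_cosetCongr_quotientMeasure` (naturality of `quotientMeasure`)
import HarnessLib

/-!
# F0 · P3c · line LH6 «StCharTS» — road «JAC-ELL» brick (Q9): TRANSPORT OF THE LOCAL TUBE-JACOBIAN SOCKET ALONG AN ISOMORPHISM OF
# TOPOLOGICAL GROUPS (Harish-Chandra 1970 Lemma 22; Deitmar–Echterhoff Thm. 1.5.3)

Cell `pub/hodgecm-mathlib`, crux H413 = `stmt-HodgeConjecture-24833` (lane `--supports`, helper); seat A-p12 (g29), brick (Q9) of the road «JAC-ELL»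
(LH5-p02 (g6), `ROAD-JAC-ELL.v1`, deal 2026-09-02T15:22:33Z).  GENERIC (Mathlib + ★ `quotientMeasure` API only); THEOREMS ONLY; sorry-free; no definition ∕
instance ∕ notation ∕ named fact; axioms TRIO.

WHAT.  The LOCAL TUBE-JACOBIAN SOCKET `hJacLoc` of ★ p851645 `…WeylHypJacobianLocal` (:70–:80) ∕ (E1b) `…WeylCartanJacobian` (token shape, at a closed subgroup
`T ≤ G`, a family `Φ : G⧸T × T → G`, Haar-type measures `ν` on `G`, `tm` on `T`, `μ₀ = quotientMeasure T tm ν`, a weight `F : T → [0, ∞]`, a «regular»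
predicate `P` on `G`):

  `∀ t₀ : T, P t₀ → ∃ U ∋ t₀ open, ∃ A₀ ⊆ G ⧸ T measurable, μ₀ A₀ ≠ 0, μ₀ A₀ ≠ ∞, ∀ V ⊆ U measurable, (∀ t ∈ V, P t) → (V is W-free) →`
  `ν (Φ '' (A₀ ×ˢ V)) = μ₀ A₀ * ∫⁻ t in V, F t ∂tm`,

is TRANSPORTED along a homeomorphic group isomorphism `e : G ≃* G'` (continuous with continuous inverse) to the matching data on `G'`: `T' = e(T)`
(`hTT' : e g ∈ T' ↔ g ∈ T`), `ν' = e_* ν`, `tm' = (e|_T)_* tm` (★ `subgroupCongrHomeomorph`), `Φ'` with `e (Φ (q, t)) = Φ' (ē q, e|_T t)` (`ē` = ★ `cosetCongr`),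
`F' ∘ e|_T = F`, `P' ∘ e = P`.  Three forms:

* **`tubeJacobianLocal_map_of_mulEquiv`** — socket for `(G, T, ν, tm, Φ, F, P)` ⇒ socket for `(G', T', ν', tm', Φ', F', P')` (push-forward);
* **`tubeJacobianLocal_of_mulEquiv_map`** — socket for `(G', …)` ⇒ socket for `(G, …)` (pull-back: the form the MODEL-to-datum transfer uses, `e` = ★
  `localNonsplitEquiv : Gqs L v ≃ₜ* U(J_w)(L_w)`, the model side carrying the computation (C8b));
* **`tubeJacobianLocal_iff_of_mulEquiv`** — the equivalence;
* `coe`-shape corollary **`tubeJacobianLocal_of_mulEquiv_map_nnreal`** with an `ℝ≥0`-valued weight `(D t : ℝ≥0∞)` exactly as the socket prints it, and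
  **`map_conjFamily_eq_conjFamily`** — the compatibility `e (Φ (q, t)) = Φ' (ē q, e t)` holds for the conjugation families `Φ (xT, t) = x t x⁻¹`.
* §1 kit (so that the model theorem's instance binders are discharged BY NAME at `ν' = e_* ν`, `tm' = (e|_T)_* tm`): `isHaarMeasure_map_mulEquiv`,
  `isMulRightInvariant_map_mulEquiv`, `isMulLeftInvariant_map_subgroupCongr`, `isFiniteMeasureOnCompacts_map_subgroupCongr`, `isOpenPosMeasure_map_subgroupCongr`,
  `isInvInvariant_map_subgroupCongr`.

PROOF.  Push `U`, `A₀`, `V` through `e`: `U' = e|_T '' U`, `A₀' = ē '' A₀`, and read `V' ⊆ U'` back as `V = (e|_T)⁻¹' V'`; `μ₀' = ē_* μ₀` is ★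
`map_cosetCongr_quotientMeasure` [DeitmarEchterhoff2014 Thm. 1.5.3] so `μ₀' A₀' = μ₀ A₀`; `Φ' '' (A₀' ×ˢ V') = e '' (Φ '' (A₀ ×ˢ V))` so `ν' (…) = ν (…)`
(`Measure.map` along a measurable equivalence, no measurability of the tube needed); `∫⁻_{V'} F' dtm' = ∫⁻_V F dtm`; regularity and `W`-freeness are
equivariant.  The content is Harish-Chandra's remark that the Jacobian of conjugation is intrinsic to the topological group [HarishChandra1970, Lemma 22].

HONEST LABEL: count-neutral; closes no organ (it moves the socket, it does not pay it).  HC_CM is proved only modulo the 7 printed citations (2 remaining: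
hLiu418 = `stmt-HodgeConjecture-24832`, h413 = `stmt-HodgeConjecture-24833`) until rung 0 closes.

## References
* [HarishChandra1970] Harish-Chandra (notes by G. van Dijk), *Harmonic analysis on reductive p-adic groups*, LNM 162 (1970), Part V §4 Lemma 22.
* [DeitmarEchterhoff2014] A. Deitmar, S. Echterhoff, *Principles of Harmonic Analysis*, 2nd ed. (2014), Thm. 1.5.3 (the invariant quotient measure is canonical).
-/

set_option autoImplicit false
-- the mandated namespace has the single-problem summit's repeated segment (`HodgeConjecture.HodgeConjecture`)
set_option linter.dupNamespace false

noncomputable section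

open MeasureTheory Measure Set Filter Topology Function
open Literature.MeasureTheory.Group
open scoped ENNReal NNReal Pointwise

namespace Summit.HodgeConjecture.HodgeConjecture.Cruxes.H413.F0P3cStCharTSTubeJacobianTransport

/-! ## §1 Kit: Haar-type properties of the transported measures `e_* ν`, `(e|_T)_* tm` -/

section Kit

variable {G G' : Type*} [Group G] [Group G'] [TopologicalSpace G] [TopologicalSpace G']
  [IsTopologicalGroup G] [IsTopologicalGroup G'] [MeasurableSpace G] [BorelSpace G] [MeasurableSpace G'] [BorelSpace G']
  (e : G ≃* G') (he : Continuous e) (hes : Continuous e.symm)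
  (T : Subgroup G) (T' : Subgroup G') (hTT' : ∀ g, e g ∈ T' ↔ g ∈ T)

include he hes in
/-- `e_* ν` is a Haar measure when `ν` is (Mathlib `MulEquiv.isHaarMeasure_map`, restated with this file's binders). [folklore] -/
theorem isHaarMeasure_map_mulEquiv [LocallyCompactSpace G] (ν : Measure G) [IsHaarMeasure ν] : IsHaarMeasure (Measure.map e ν) :=
  MulEquiv.isHaarMeasure_map ν e he hes

omit [TopologicalSpace G] [TopologicalSpace G'] [IsTopologicalGroup G] [IsTopologicalGroup G'] [BorelSpace G] [BorelSpace G'] in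
/-- `e_* ν` is right invariant when `ν` is (the mirror of Mathlib `isMulLeftInvariant_map`). [folklore] -/
theorem isMulRightInvariant_map_mulEquiv [MeasurableMul G] [MeasurableMul G'] (hem : Measurable e) (ν : Measure G) [ν.IsMulRightInvariant] :
    (Measure.map e ν).IsMulRightInvariant := by
  refine ⟨fun b => ?_⟩
  rw [Measure.map_map (measurable_mul_const b) hem]
  obtain ⟨a, rfl⟩ := e.surjective b
  conv_rhs => rw [← map_mul_right_eq_self ν a]
  rw [Measure.map_map hem (measurable_mul_const a)]
  congr 1
  ext x
  simp only [Function.comp_apply, map_mul]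

/-- `(e|_T)_* tm` is left invariant when `tm` is (Mathlib `isMulLeftInvariant_map` for the multiplicative bijection `e|_T : T → T'`). [folklore] -/
theorem isMulLeftInvariant_map_subgroupCongr (tm : Measure T) [tm.IsMulLeftInvariant] :
    (Measure.map (subgroupCongrHomeomorph e T T' hTT' he hes) tm).IsMulLeftInvariant := by
  let f : T →ₙ* T' := ⟨fun t => subgroupCongrHomeomorph e T T' hTT' he hes t, fun a b => Subtype.ext (by simp only [coe_subgroupCongrHomeomorph_apply, Subgroup.coe_mul, map_mul])⟩
  have hf : ⇑f = ⇑(subgroupCongrHomeomorph e T T' hTT' he hes) := rfl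
  have h := isMulLeftInvariant_map (μ := tm) f (hf ▸ (subgroupCongrHomeomorph e T T' hTT' he hes).continuous.measurable)
    (hf ▸ (subgroupCongrHomeomorph e T T' hTT' he hes).surjective)
  rwa [hf] at h

omit [IsTopologicalGroup G] [IsTopologicalGroup G'] in
/-- `(e|_T)_* tm` is finite on compact sets when `tm` is. [folklore] -/
theorem isFiniteMeasureOnCompacts_map_subgroupCongr (tm : Measure T) [IsFiniteMeasureOnCompacts tm] :
    IsFiniteMeasureOnCompacts (Measure.map (subgroupCongrHomeomorph e T T' hTT' he hes) tm) :=
  IsFiniteMeasureOnCompacts.map tm (subgroupCongrHomeomorph e T T' hTT' he hes)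

omit [IsTopologicalGroup G] [IsTopologicalGroup G'] in
/-- `(e|_T)_* tm` is positive on open sets when `tm` is. [folklore] -/
theorem isOpenPosMeasure_map_subgroupCongr (tm : Measure T) [tm.IsOpenPosMeasure] :
    (Measure.map (subgroupCongrHomeomorph e T T' hTT' he hes) tm).IsOpenPosMeasure :=
  (subgroupCongrHomeomorph e T T' hTT' he hes).continuous.isOpenPosMeasure_map (subgroupCongrHomeomorph e T T' hTT' he hes).surjective

/-- `(e|_T)_* tm` is inversion invariant when `tm` is (★ `isInvInvariant_map_mulEquiv` for the multiplicative bijection `e|_T`). [folklore] -/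
theorem isInvInvariant_map_subgroupCongr (tm : Measure T) [tm.IsInvInvariant] :
    (Measure.map (subgroupCongrHomeomorph e T T' hTT' he hes) tm).IsInvInvariant := by
  let f : T ≃* T' :=
    { toFun := fun h => ⟨e h, (hTT' h).2 h.2⟩
      invFun := fun h' => ⟨e.symm h', (forall_symm_mem_iff e T T' hTT' h').2 h'.2⟩
      left_inv := fun h => Subtype.ext (e.symm_apply_apply h)
      right_inv := fun h' => Subtype.ext (e.apply_symm_apply h')
      map_mul' := fun a b => Subtype.ext (by simp only [Subgroup.coe_mul, map_mul]) }
  have hf : ⇑f = ⇑(subgroupCongrHomeomorph e T T' hTT' he hes) := rfl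
  have h := isInvInvariant_map_mulEquiv f (hf ▸ (subgroupCongrHomeomorph e T T' hTT' he hes).continuous.measurable) tm
  rwa [hf] at h

omit [IsTopologicalGroup G] [IsTopologicalGroup G'] [MeasurableSpace G] [BorelSpace G] [MeasurableSpace G'] [BorelSpace G'] in
/-- **Conjugation families are compatible with `e`**: if `Φ (xT, t) = x t x⁻¹` on `G` and `Φ' (yT', t') = y t' y⁻¹` on `G'`, then
`e (Φ (q, t)) = Φ' (ē q, e|_T t)` with `ē` = ★ `cosetCongr e`. [folklore] -/
theorem map_conjFamily_eq_conjFamily (Φ : (G ⧸ T) × T → G) (hΦ : ∀ (x : G) (t : T), Φ (QuotientGroup.mk x, t) = x * t * x⁻¹)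
    (Φ' : (G' ⧸ T') × T' → G') (hΦ' : ∀ (y : G') (t' : T'), Φ' (QuotientGroup.mk y, t') = y * t' * y⁻¹)
    (q : G ⧸ T) (t : T) :
    e (Φ (q, t)) = Φ' (cosetCongr e T T' hTT' q, subgroupCongrHomeomorph e T T' hTT' he hes t) := by
  induction q using QuotientGroup.induction_on with
  | H x => rw [hΦ, cosetCongr_mk, hΦ', coe_subgroupCongrHomeomorph_apply, map_mul, map_mul, map_inv]

end Kit

/-! ## §2 Transport of the local tube-Jacobian socket -/

section Transport

variable {G G' : Type*} [Group G] [Group G'] [TopologicalSpace G] [TopologicalSpace G']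
  [IsTopologicalGroup G] [IsTopologicalGroup G'] [LocallyCompactSpace G] [LocallyCompactSpace G']
  [SecondCountableTopology G] [SecondCountableTopology G'] [T2Space G] [T2Space G']
  [MeasurableSpace G] [BorelSpace G] [MeasurableSpace G'] [BorelSpace G']
  (e : G ≃* G') (he : Continuous e) (hes : Continuous e.symm)
  (T : Subgroup G) (hT : IsClosed (T : Set G)) (T' : Subgroup G') (hT' : IsClosed (T' : Set G'))
  (hTT' : ∀ g, e g ∈ T' ↔ g ∈ T)
  [MeasurableSpace (G ⧸ T)] [BorelSpace (G ⧸ T)] [MeasurableSpace (G' ⧸ T')] [BorelSpace (G' ⧸ T')]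
  (ν : Measure G) [ν.IsHaarMeasure] [ν.IsMulRightInvariant]
  (ν' : Measure G') [ν'.IsHaarMeasure] [ν'.IsMulRightInvariant]
  (tm : Measure T) [tm.IsMulLeftInvariant] [IsFiniteMeasureOnCompacts tm] [tm.IsOpenPosMeasure] [tm.IsInvInvariant]
  (tm' : Measure T') [tm'.IsMulLeftInvariant] [IsFiniteMeasureOnCompacts tm'] [tm'.IsOpenPosMeasure] [tm'.IsInvInvariant]
  (hν' : ν' = Measure.map e ν) (htm' : tm' = Measure.map (subgroupCongrHomeomorph e T T' hTT' he hes) tm)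
  (Φ : (G ⧸ T) × T → G) (Φ' : (G' ⧸ T') × T' → G')
  (hΦΦ' : ∀ (q : G ⧸ T) (t : T), e (Φ (q, t)) = Φ' (cosetCongr e T T' hTT' q, subgroupCongrHomeomorph e T T' hTT' he hes t))
  (F : T → ℝ≥0∞) (F' : T' → ℝ≥0∞) (hFF' : ∀ t : T, F' (subgroupCongrHomeomorph e T T' hTT' he hes t) = F t)
  (P : G → Prop) (P' : G' → Prop) (hPP' : ∀ g : G, P' (e g) ↔ P g)

include he hes hTT' hν' htm' hΦΦ' hFF' hPP' in
/-- **TRANSPORT OF THE LOCAL TUBE-JACOBIAN SOCKET, PUSH-FORWARD FORM.**  For a homeomorphic group isomorphism `e : G ≃* G'`, closed subgroups `T ≤ G`, `T' = e(T) ≤ G'`,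
Haar-type measures `ν' = e_* ν`, `tm' = (e|_T)_* tm`, families `Φ, Φ'` with `e ∘ Φ = Φ' ∘ (ē × e|_T)`, weights `F' ∘ e|_T = F` and predicates `P' ∘ e = P`: if the
socket holds for `(G, T, ν, tm, Φ, F, P)` — every `P`-regular `t₀ ∈ T` has an open `U ∋ t₀` in `T` and a measurable `A₀ ⊆ G ⧸ T` of positive finite
`μ₀ = ν∕tm`-measure with `ν(Φ(A₀ × V)) = μ₀(A₀) · ∫⁻_V F dtm` for every measurable, `P`-regular, `W`-free `V ⊆ U` — then it holds for `(G', T', ν', tm', Φ', F', P')`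
(with `U' = e|_T(U)`, `A₀' = ē(A₀)`; `μ₀' = ē_* μ₀` by ★ `map_cosetCongr_quotientMeasure`). [cite: HarishChandra1970, Lemma 22] [cite: DeitmarEchterhoff2014, Thm. 1.5.3] -/
theorem tubeJacobianLocal_map_of_mulEquiv
    (hJacLoc : ∀ t₀ : T, P (t₀ : G) →
      ∃ U : Set T, IsOpen U ∧ t₀ ∈ U ∧
        ∃ A₀ : Set (G ⧸ T), MeasurableSet A₀ ∧ (quotientMeasure T tm hT ν) A₀ ≠ 0 ∧ (quotientMeasure T tm hT ν) A₀ ≠ ∞ ∧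
          ∀ V : Set T, MeasurableSet V → V ⊆ U → (∀ t ∈ V, P (t : G)) →
            (∀ n : G, n ∉ T → ∀ t ∈ V, ∀ t' ∈ V, ((t' : T) : G) ≠ n * t * n⁻¹) →
              ν (Φ '' (A₀ ×ˢ V)) = (quotientMeasure T tm hT ν) A₀ * ∫⁻ t in V, F t ∂tm) :
    ∀ t₀ : T', P' (t₀ : G') →
      ∃ U : Set T', IsOpen U ∧ t₀ ∈ U ∧
        ∃ A₀ : Set (G' ⧸ T'), MeasurableSet A₀ ∧ (quotientMeasure T' tm' hT' ν') A₀ ≠ 0 ∧ (quotientMeasure T' tm' hT' ν') A₀ ≠ ∞ ∧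
          ∀ V : Set T', MeasurableSet V → V ⊆ U → (∀ t ∈ V, P' (t : G')) →
            (∀ n : G', n ∉ T' → ∀ t ∈ V, ∀ t' ∈ V, ((t' : T') : G') ≠ n * t * n⁻¹) →
              ν' (Φ' '' (A₀ ×ˢ V)) = (quotientMeasure T' tm' hT' ν') A₀ * ∫⁻ t in V, F' t ∂tm' := by
  classical
  -- §a the three measurable equivalences `e`, `e|_T`, `ē` and σ-finiteness of `tm`, `tm'`
  set eT : T ≃ₜ T' := subgroupCongrHomeomorph e T T' hTT' he hes with heT
  set eG : G ≃ᵐ G' := (Homeomorph.mk e.toEquiv he hes).toMeasurableEquiv with heG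
  have heGc : ⇑eG = ⇑e := rfl
  set eQ : G ⧸ T ≃ₜ G' ⧸ T' := cosetCongrHomeomorph e T T' hTT' he hes with heQ
  have heQc : ⇑eQ = cosetCongr e T T' hTT' := rfl
  haveI : IsClosed (T : Set G) := hT
  haveI : IsClosed (T' : Set G') := hT'
  haveI : LocallyCompactSpace T := hT.locallyCompactSpace
  haveI : LocallyCompactSpace T' := hT'.locallyCompactSpace
  haveI : SecondCountableTopology T := TopologicalSpace.Subtype.secondCountableTopology _
  haveI : SecondCountableTopology T' := TopologicalSpace.Subtype.secondCountableTopology _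
  haveI : SigmaCompactSpace T := sigmaCompactSpace_of_locallyCompact_secondCountable
  haveI : SigmaCompactSpace T' := sigmaCompactSpace_of_locallyCompact_secondCountable
  haveI : SigmaFinite tm := SigmaFinite.of_isFiniteMeasureOnCompacts _
  haveI : SigmaFinite tm' := SigmaFinite.of_isFiniteMeasureOnCompacts _
  -- §b naturality of the quotient measure: `μ₀' = ē_* μ₀`
  have hμ : quotientMeasure T' tm' hT' ν' = Measure.map eQ.toMeasurableEquiv (quotientMeasure T tm hT ν) := by
    rw [← map_cosetCongr_quotientMeasure e he hes T T' hTT' tm tm' ν ν' htm' hν']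
    rfl
  have hμA : ∀ A : Set (G ⧸ T), quotientMeasure T' tm' hT' ν' (eQ '' A) = quotientMeasure T tm hT ν A := fun A => by
    rw [hμ, MeasurableEquiv.map_apply, Homeomorph.toMeasurableEquiv_coe, eQ.injective.preimage_image]
  -- §c the transport
  intro t₀' ht₀'
  have ht₀ : P ((eT.symm t₀' : T) : G) := by
    rw [← hPP']
    have : e ((eT.symm t₀' : T) : G) = (t₀' : G') := by
      rw [heT]; exact e.apply_symm_apply _
    rw [this]; exact ht₀'
  obtain ⟨U, hUo, ht₀U, A₀, hA₀m, hA₀0, hA₀top, hJ⟩ := hJacLoc (eT.symm t₀') ht₀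
  refine ⟨eT '' U, eT.isOpenMap U hUo, ⟨eT.symm t₀', ht₀U, eT.apply_symm_apply t₀'⟩, eQ '' A₀,
    eQ.toMeasurableEquiv.measurableSet_image.2 hA₀m, by rwa [hμA], by rwa [hμA], fun V' hV'm hV'U hV'reg hV'free => ?_⟩
  -- read `V'` back on `T`
  set V : Set T := eT ⁻¹' V' with hVdef
  have hVm : MeasurableSet V := hV'm.preimage eT.continuous.measurable
  have hVU : V ⊆ U := fun t ht => by
    obtain ⟨u, hu, hut⟩ := hV'U ht
    rwa [← eT.injective hut]
  have hVreg : ∀ t ∈ V, P (t : G) := fun t ht => by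
    rw [← hPP']
    have h1 := hV'reg (eT t) ht
    rwa [heT, coe_subgroupCongrHomeomorph_apply] at h1
  have hVfree : ∀ n : G, n ∉ T → ∀ t ∈ V, ∀ t' ∈ V, ((t' : T) : G) ≠ n * t * n⁻¹ := by
    intro n hn t ht t' ht' hc
    have hn' : e n ∉ T' := fun h => hn ((hTT' n).1 h)
    refine hV'free (e n) hn' (eT t) ht (eT t') ht' ?_
    rw [heT, coe_subgroupCongrHomeomorph_apply, coe_subgroupCongrHomeomorph_apply, hc, map_mul, map_mul, map_inv]
  have hJV := hJ V hVm hVU hVreg hVfree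
  -- the tube: `Φ' '' (ē A₀ ×ˢ V') = e '' (Φ '' (A₀ ×ˢ V))`
  have himg : Φ' '' ((eQ '' A₀) ×ˢ V') = e '' (Φ '' (A₀ ×ˢ V)) := by
    ext y
    simp only [Set.mem_image, Set.mem_prod, Prod.exists]
    constructor
    · rintro ⟨q', t', ⟨⟨q, hq, rfl⟩, ht'⟩, rfl⟩
      refine ⟨Φ (q, eT.symm t'), ⟨q, eT.symm t', ⟨hq, ?_⟩, rfl⟩, ?_⟩
      · show eT (eT.symm t') ∈ V'
        rwa [eT.apply_symm_apply]
      · rw [hΦΦ', eT.apply_symm_apply, ← heQc]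
    · rintro ⟨x, ⟨q, t, ⟨hq, ht⟩, rfl⟩, rfl⟩
      exact ⟨eQ q, eT t, ⟨⟨q, hq, rfl⟩, ht⟩, by rw [hΦΦ', heQc, heT]⟩
  -- the left side: `ν' (e '' S) = ν S`
  have hL : ν' (Φ' '' ((eQ '' A₀) ×ˢ V')) = ν (Φ '' (A₀ ×ˢ V)) := by
    rw [himg, hν', ← heGc, MeasurableEquiv.map_apply, eG.injective.preimage_image]
  -- the right side: `∫⁻_{V'} F' dtm' = ∫⁻_V F dtm`
  have hR : ∫⁻ t in V', F' t ∂tm' = ∫⁻ t in V, F t ∂tm := by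
    rw [htm', ← Homeomorph.toMeasurableEquiv_coe, MeasurableEquiv.restrict_map, lintegral_map_equiv]
    simp only [Homeomorph.toMeasurableEquiv_coe]
    exact lintegral_congr fun t => hFF' t
  rw [hL, hR, hμA, hJV]

include he hes hTT' hν' htm' hΦΦ' hFF' hPP' in
/-- **TRANSPORT OF THE LOCAL TUBE-JACOBIAN SOCKET, PULL-BACK FORM** (the MODEL-to-datum direction): with the data of `tubeJacobianLocal_map_of_mulEquiv`, if the
socket holds on `G'` for `(T', ν' = e_* ν, tm' = (e|_T)_* tm, Φ', F', P')` then it holds on `G` for `(T, ν, tm, Φ, F, P)` — apply the push-forward form to `e⁻¹`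
(`(e⁻¹)_* ν' = ν`, `(e⁻¹|_{T'})_* tm' = tm`). [cite: HarishChandra1970, Lemma 22] [cite: DeitmarEchterhoff2014, Thm. 1.5.3] -/
theorem tubeJacobianLocal_of_mulEquiv_map
    (hJacLoc' : ∀ t₀ : T', P' (t₀ : G') →
      ∃ U : Set T', IsOpen U ∧ t₀ ∈ U ∧
        ∃ A₀ : Set (G' ⧸ T'), MeasurableSet A₀ ∧ (quotientMeasure T' tm' hT' ν') A₀ ≠ 0 ∧ (quotientMeasure T' tm' hT' ν') A₀ ≠ ∞ ∧
          ∀ V : Set T', MeasurableSet V → V ⊆ U → (∀ t ∈ V, P' (t : G')) →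
            (∀ n : G', n ∉ T' → ∀ t ∈ V, ∀ t' ∈ V, ((t' : T') : G') ≠ n * t * n⁻¹) →
              ν' (Φ' '' (A₀ ×ˢ V)) = (quotientMeasure T' tm' hT' ν') A₀ * ∫⁻ t in V, F' t ∂tm') :
    ∀ t₀ : T, P (t₀ : G) →
      ∃ U : Set T, IsOpen U ∧ t₀ ∈ U ∧
        ∃ A₀ : Set (G ⧸ T), MeasurableSet A₀ ∧ (quotientMeasure T tm hT ν) A₀ ≠ 0 ∧ (quotientMeasure T tm hT ν) A₀ ≠ ∞ ∧
          ∀ V : Set T, MeasurableSet V → V ⊆ U → (∀ t ∈ V, P (t : G)) →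
            (∀ n : G, n ∉ T → ∀ t ∈ V, ∀ t' ∈ V, ((t' : T) : G) ≠ n * t * n⁻¹) →
              ν (Φ '' (A₀ ×ˢ V)) = (quotientMeasure T tm hT ν) A₀ * ∫⁻ t in V, F t ∂tm := by
  -- the data of `e⁻¹`: `(e⁻¹)_* ν' = ν`, `(e⁻¹|_{T'})_* tm' = tm`, and the compatibilities read backwards
  have hT'T : ∀ g', e.symm g' ∈ T ↔ g' ∈ T' := forall_symm_mem_iff e T T' hTT'
  set eT : T ≃ₜ T' := subgroupCongrHomeomorph e T T' hTT' he hes with heT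
  have heT' : ⇑(subgroupCongrHomeomorph e.symm T' T hT'T hes he) = ⇑eT.symm := rfl
  set eG : G ≃ᵐ G' := (Homeomorph.mk e.toEquiv he hes).toMeasurableEquiv with heG
  have heGc : ⇑eG = ⇑e := rfl
  have heGs : ⇑eG.symm = ⇑e.symm := rfl
  have hν : ν = Measure.map e.symm ν' := by
    rw [hν', ← heGc, ← heGs, MeasurableEquiv.map_symm_map]
  have htm : tm = Measure.map (subgroupCongrHomeomorph e.symm T' T hT'T hes he) tm' := by
    rw [heT', htm']
    exact (MeasurableEquiv.map_symm_map eT.toMeasurableEquiv).symm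
  have hΦ'Φ : ∀ (q' : G' ⧸ T') (t' : T'),
      e.symm (Φ' (q', t')) = Φ (cosetCongr e.symm T' T hT'T q', subgroupCongrHomeomorph e.symm T' T hT'T hes he t') := by
    intro q' t'
    apply e.injective
    rw [e.apply_symm_apply, hΦΦ', cosetCongr_apply_symm, heT', Homeomorph.apply_symm_apply]
  have hF'F : ∀ t' : T', F (subgroupCongrHomeomorph e.symm T' T hT'T hes he t') = F' t' := by
    intro t'
    rw [heT', ← hFF' (eT.symm t'), Homeomorph.apply_symm_apply]
  have hP'P : ∀ g' : G', P (e.symm g') ↔ P' g' := fun g' => by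
    rw [← hPP', e.apply_symm_apply]
  exact tubeJacobianLocal_map_of_mulEquiv e.symm hes he T' hT' T hT hT'T ν' ν tm' tm hν htm Φ' Φ hΦ'Φ F' F hF'F P' P hP'P hJacLoc'

include he hes hTT' hν' htm' hΦΦ' hFF' hPP' in
/-- **THE LOCAL TUBE-JACOBIAN SOCKET IS INVARIANT UNDER ISOMORPHISMS OF TOPOLOGICAL GROUPS**: with the data of `tubeJacobianLocal_map_of_mulEquiv`, the socket
holds for `(G, T, ν, tm, Φ, F, P)` iff it holds for `(G', T', ν' = e_* ν, tm' = (e|_T)_* tm, Φ', F', P')`. [cite: HarishChandra1970, Lemma 22]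
[cite: DeitmarEchterhoff2014, Thm. 1.5.3] -/
theorem tubeJacobianLocal_iff_of_mulEquiv :
    (∀ t₀ : T, P (t₀ : G) →
      ∃ U : Set T, IsOpen U ∧ t₀ ∈ U ∧
        ∃ A₀ : Set (G ⧸ T), MeasurableSet A₀ ∧ (quotientMeasure T tm hT ν) A₀ ≠ 0 ∧ (quotientMeasure T tm hT ν) A₀ ≠ ∞ ∧
          ∀ V : Set T, MeasurableSet V → V ⊆ U → (∀ t ∈ V, P (t : G)) →
            (∀ n : G, n ∉ T → ∀ t ∈ V, ∀ t' ∈ V, ((t' : T) : G) ≠ n * t * n⁻¹) →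
              ν (Φ '' (A₀ ×ˢ V)) = (quotientMeasure T tm hT ν) A₀ * ∫⁻ t in V, F t ∂tm) ↔
    (∀ t₀ : T', P' (t₀ : G') →
      ∃ U : Set T', IsOpen U ∧ t₀ ∈ U ∧
        ∃ A₀ : Set (G' ⧸ T'), MeasurableSet A₀ ∧ (quotientMeasure T' tm' hT' ν') A₀ ≠ 0 ∧ (quotientMeasure T' tm' hT' ν') A₀ ≠ ∞ ∧
          ∀ V : Set T', MeasurableSet V → V ⊆ U → (∀ t ∈ V, P' (t : G')) →
            (∀ n : G', n ∉ T' → ∀ t ∈ V, ∀ t' ∈ V, ((t' : T') : G') ≠ n * t * n⁻¹) →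
              ν' (Φ' '' (A₀ ×ˢ V)) = (quotientMeasure T' tm' hT' ν') A₀ * ∫⁻ t in V, F' t ∂tm') :=
  ⟨tubeJacobianLocal_map_of_mulEquiv e he hes T hT T' hT' hTT' ν ν' tm tm' hν' htm' Φ Φ' hΦΦ' F F' hFF' P P' hPP',
    tubeJacobianLocal_of_mulEquiv_map e he hes T hT T' hT' hTT' ν ν' tm tm' hν' htm' Φ Φ' hΦΦ' F F' hFF' P P' hPP'⟩

include he hes hTT' hν' htm' hΦΦ' hPP' in
/-- **PULL-BACK FORM IN THE SOCKET'S PRINTED SHAPE** (`ℝ≥0`-valued weights `D`, `D'` with `D' ∘ e|_T = D`, integrand `(D t : ℝ≥0∞)` as ★ p851645 ∕ (E1b) print it):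
socket on `G'` for `(T', e_* ν, (e|_T)_* tm, Φ', D', P')` ⇒ socket on `G` for `(T, ν, tm, Φ, D, P)`.  For conjugation families `Φ (xT, t) = x t x⁻¹`,
`Φ' (yT', t') = y t' y⁻¹` the compatibility `hΦΦ'` is `map_conjFamily_eq_conjFamily`. [cite: HarishChandra1970, Lemma 22] [cite: DeitmarEchterhoff2014, Thm. 1.5.3] -/
theorem tubeJacobianLocal_of_mulEquiv_map_nnreal (D : T → ℝ≥0) (D' : T' → ℝ≥0)
    (hDD' : ∀ t : T, D' (subgroupCongrHomeomorph e T T' hTT' he hes t) = D t)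
    (hJacLoc' : ∀ t₀ : T', P' (t₀ : G') →
      ∃ U : Set T', IsOpen U ∧ t₀ ∈ U ∧
        ∃ A₀ : Set (G' ⧸ T'), MeasurableSet A₀ ∧ (quotientMeasure T' tm' hT' ν') A₀ ≠ 0 ∧ (quotientMeasure T' tm' hT' ν') A₀ ≠ ∞ ∧
          ∀ V : Set T', MeasurableSet V → V ⊆ U → (∀ t ∈ V, P' (t : G')) →
            (∀ n : G', n ∉ T' → ∀ t ∈ V, ∀ t' ∈ V, ((t' : T') : G') ≠ n * t * n⁻¹) →
              ν' (Φ' '' (A₀ ×ˢ V)) = (quotientMeasure T' tm' hT' ν') A₀ * ∫⁻ t in V, (D' t : ℝ≥0∞) ∂tm') :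
    ∀ t₀ : T, P (t₀ : G) →
      ∃ U : Set T, IsOpen U ∧ t₀ ∈ U ∧
        ∃ A₀ : Set (G ⧸ T), MeasurableSet A₀ ∧ (quotientMeasure T tm hT ν) A₀ ≠ 0 ∧ (quotientMeasure T tm hT ν) A₀ ≠ ∞ ∧
          ∀ V : Set T, MeasurableSet V → V ⊆ U → (∀ t ∈ V, P (t : G)) →
            (∀ n : G, n ∉ T → ∀ t ∈ V, ∀ t' ∈ V, ((t' : T) : G) ≠ n * t * n⁻¹) →
              ν (Φ '' (A₀ ×ˢ V)) = (quotientMeasure T tm hT ν) A₀ * ∫⁻ t in V, (D t : ℝ≥0∞) ∂tm :=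
  tubeJacobianLocal_of_mulEquiv_map e he hes T hT T' hT' hTT' ν ν' tm tm' hν' htm' Φ Φ' hΦΦ' (fun t => (D t : ℝ≥0∞)) (fun t' => (D' t' : ℝ≥0∞))
    (fun t => by rw [hDD']) P P' hPP' hJacLoc'

end Transport

end Summit.HodgeConjecture.HodgeConjecture.Cruxes.H413.F0P3cStCharTSTubeJacobianTransport
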